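import Literature.NumberTheory.GaloisCohomology.Howard2004.RelaxedSelmerIsotropyProofs
import Literature.NumberTheory.GaloisCohomology.Howard2004.DualityDatumLocalCupAnnihilatorLeftProofs
import Literature.NumberTheory.GaloisCohomology.Howard2004.TransportConnectingKernelProofs
import Literature.NumberTheory.GaloisCohomology.Howard2004.InertLocalTauProofs
import Literature.NumberTheory.GaloisCohomology.PoitouTateSelmerStructures
import Literature.NumberTheory.GaloisRepresentations.GaloisH1MapBijectiveUnramified
import Literature.NumberTheory.EllipticCurves.HeegnerPointsKolyvaginPairing
import HarnessLib

/-!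
# Howard 2004, Lemma 1.5.6, the `⊇` half «`A^⟂ ⊆ A`» at an inert prime: the local image of the
# relaxed Selmer group is its own annihilator under the induced local pairing (proofs file)

Topic `NumberTheory/GaloisCohomology/Howard2004`. THEOREMS ONLY: no definition, no named fact, no
instance, no notation, no `sorry`. Sequel to `RelaxedSelmerIsotropyProofs` (the `⊆` half «`A ⊆ A^⟂`»,
seat `bsd-line-x10b-p1-w5` g7) in the same currency; cell `pub/bsd-print-x9`, print leaf G87
`Literature.NumberTheory.GaloisCohomology.Howard2004.thm161_dvrKolyvaginBound` (Howard Thm. 1.6.1);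
seat `bsd-line-x9-p1-w4` g16, brick (A-PERP).

SOURCE. B. Howard, *The Heegner point Kolyvagin system*, Compositio Math. **140** (2004) =
arXiv:1202.6340, Lemma 1.5.6 (arXiv Lemma 2.5.6, p. 10 L80–97): «For `mn ∈ 𝓝`, the image of `𝓗^m(n)` in
`⊕_{λ∣m} H¹(K_λ, T)` is maximal isotropic under the sum of the local Tate pairings. *Proof.* Let `A` be the
image […] which shows that `A ⊂ A^⟂`. By global duality (Theorem 1.1.11) `len(A) = len(𝓗^m(n)/𝓗(n)) +
len(𝓗(n)/𝓗_m(n)) = 2k·ν(m)`. The sum of the lengths of `A` and `A^⟂` must be `4k·ν(m)` and we conclude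
that `len(A) = len(A^⟂)` and so `A = A^⟂`.» Theorem 1.1.11 (arXiv 2.1.11, p. 6) is Poitou–Tate global
duality for Selmer structures `𝓕 ≤ 𝓖`: «the images of the rightmost arrows are exact orthogonal
complements», in the tree `LocalInvariants.SelmerComplement` (`PoitouTateSelmerStructures.lean`).

WHAT IS PROVED (`m = q` ONE inert prime, the case used in Lemma 1.5.7 / Prop. 1.5.9; general H.4 datum
`D : DualityDatum p cd ρ R` on a finite `T` killed by `p^k`, read through `(λ, exp)` as in
`DualityDatumTateDualBridge`, `Θ = D.toTateDual λ exp` bijective, `(r_i)` a DUALIZING family of `R`):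
* §1 **`ConjugationDatum.pullback_conj_one_surjective`**: the global twist `τ^* : H¹(K, T) → H¹(K, Tw T)`
  is onto (`τ` is an involution: the class of `g ∘ τ` maps to the class of `g`); hence
  `DualityDatum.exists_eq_map_toTateDual_pullback`: every class of `H¹(K, T^∨(1))` is `Θ_*(τ^* d)`.
* §2 **`DualityDatum.localization_smul_mem_of_mem_dualLocalCondition`**: at a finite place `v` where `𝓕`
  is self-orthogonal under `D` (H.4) and `𝓕_v` is stable under the `r_i`, with `inv_v` injective: if
  `loc_v(Θ_* τ^* d)` lies in the dual local condition `(𝓕_v)^*` (annihilator under the local TATE pairing)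
  then `loc_{σ v} d ∈ 𝓕_{σ v}` — the identification «`(𝓕^*)` on `T^∨(1)` = `𝓕` on `T`» through
  `Θ ∘ τ^*`, place by place (bridge `cohomologyMap_localCup_eq_localTatePairing`, readout of `H²(K_v, R(1))`
  by the characters `exp ∘ λ_{r_i}`, H.4 clause 2, `transportH1_injective`).
* §3 **`DualityDatum.exists_mem_selmerGroup_localization_eq_of_forall_localCup_eq_zero`** («`A^⟂ ⊆ A`»):
  for `inv` with `SelmerComplement` (Howard Thm. 1.1.11, `⊇` halves) and injective `inv_v`, `S` a finite
  set of places containing `q`, the archimedean places, the places above `p` and the ramified places of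
  `T`, `𝓡` a Selmer structure unramified outside `S`, RELAXED at the inert `q` (`𝓡_q = H¹(K_q, T)`) and
  agreeing at the finite `v ≠ q` with a structure `𝓕` that is self-orthogonal under `D` and `r_i`-stable
  there, all classes of `T` localising to `0` at the infinite places (automatic for `K` imaginary
  quadratic): every `x ∈ H¹(K_q, T)` with «`x ∪_e transport_q(loc_{σ q} d) = 0` for all `d ∈ H¹_𝓡(K, T)`»
  is `loc_q c` for some `c ∈ H¹_𝓡(K, T)`.  PROOF: `SelmerComplement` (i) for the pair (𝓢 ≤ 𝓡), 𝓢 the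
  structure STRICT at `q` and equal to `𝓡` elsewhere, with the tuple `t = (x at q, 0 elsewhere)`; its
  pairing hypothesis «`∑_{v∈S} ⟨t_v, y_v⟩_v = 0` for `y ∈ H¹_{𝓢^*}(K, T^∨(1))`» reduces to the term at `q`,
  and writing `y = Θ_*(τ^* d)` (§1) the local conditions of `y` off `q` say `d ∈ H¹_𝓡(K, T)` (§2), so the
  term is `inv_q(H²(exp∘λ)(x ∪_e transport_q(loc_{σq} d))) = 0` by hypothesis; the conclusion
  `loc_q c - x ∈ 𝓢_q = 0` is the claim (Howard's length count `len A = 2k·ν` is bypassed).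
* §4 **`DualityDatum.localCup_localization_transportH1_eq_zero`** («`A ⊆ A^⟂`» for `∪_e` ITSELF, not
  only for its `ℤ/p^k`-reading: `RelaxedSelmerIsotropyProofs` + the dualizing-family readout, `𝓕` being
  `r_i`-stable); both halves: **`DualityDatum.mem_map_localization_selmerGroup_iff_forall_localCup_eq_zero`**:
  `x ∈ loc_q(H¹_𝓡(K, T)) ↔ ∀ d ∈ H¹_𝓡(K, T), x ∪_e transport_q(loc_{σ q} d) = 0` — the hypothesis
  «`A = A^⟂`» (`hA`) of the Lagrangian algebra of Lemma 1.5.7 / Prop. 1.5.9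
  (`Algebra/Module/LagrangianSubmodulesDeltaTransfer`) for `A = loc_q H¹_{𝓕^q(n)}(K, T)`;
  and its LOCAL form **`…_iff_forall_localCup_cast_eq_zero`** quantifying over `a ∈ A` (the class
  `a ∈ H¹(K_q, T)` cast to `H¹(K_{σ q}, T)` along `σ q = q`, the convention of `InertLocalTauProofs`):
  `x ∈ A ↔ ∀ a ∈ A, x ∪_e transport_q(a) = 0` — literally `∀ x, x ∈ A ↔ ∀ a ∈ A, B x a = 0`.

NOT HERE: the family `inv` (named fact `poitouTate_selmerStructure_duality`), the dualizing family /
`(λ, exp)` of a level ring, `Θ` bijective (`DualityDatumTateDualBijective`), the `R`-stability of Howard's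
conditions (Def. 1.1.1), H.4 for `𝓕(n)` at `λ ∣ n`, several primes `m`; `thm161_dvrKolyvaginBound` is NOT
proved; no summit statement is proved; the Birch–Swinnerton-Dyer conjecture is not proved by any of this.
References: [Howard2004HeegnerKolyvagin] Lemma 1.5.6, Thm. 1.1.11, §1.3 H.4, Def. 1.1.6/1.1.10;
[MilneADT2006] I Thm. 4.10(b), I Cor. 2.3; [SerreGaloisCohomology1997] I §2.2–2.4, §5.1.
-/

set_option autoImplicit false

noncomputable section

open Function NumberField IsDedekindDomain Field CategoryTheory
open scoped NumberField

namespace Literature.NumberTheory.GaloisCohomology.Howard2004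

open Literature.NumberTheory.GaloisRepresentations
open Literature.NumberTheory.GaloisRepresentations.DiscreteGaloisModule
open Literature.NumberTheory.EllipticCurves

variable {K : Type} [Field K] [NumberField K] {M : Type} [AddCommGroup M] [TopologicalSpace M]
  [DiscreteTopology M]

/-! ## §1 The global twist `τ^* : H¹(K, T) → H¹(K, Tw T)` is onto -/

namespace ConjugationDatum

/-- **`τ^*` is onto**: every class of `H¹(K, Tw T)` is the twist `τ^* d` of a class `d ∈ H¹(K, T)` (for a
cocycle `g` of `Tw T`, `a ↦ g(a^τ)` is a cocycle of `T` since `τ² = 1`, and its twist is `g`).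
[cite: Howard2004HeegnerKolyvagin, §1.3 (arXiv p. 7 L33–48: «conjugation by `τ` induces `H^i(K_v̄, T) ≅ H^i(K_v, Tw(T))`»)] [cite: SerreGaloisCohomology1997, Ch. I §2.4 and §5.1] -/
theorem pullback_conj_one_surjective (cd : ConjugationDatum K) (ρ : DiscreteGaloisModule K M) :
    Surjective (galoisCohomology.pullback ρ cd.conj 1) := by
  have hcc : ∀ g, cd.conj (cd.conj g) = g := fun g =>
    cd.isLift.conjGalCMH_conjGalCMH cd.involutive g
  intro y
  obtain ⟨g, rfl⟩ := oneCocycleClass_surjective (cd.twist ρ).toTopRep y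
  -- the untwisted cocycle `a ↦ g (a^τ)` of `T`
  let ι : TopRep.res (cd.conj : absoluteGaloisGroup K →* absoluteGaloisGroup K) (cd.twist ρ).toTopRep ⟶
      ρ.toTopRep :=
    TopRep.ofHom ⟨ContinuousLinearMap.id ℤ M, fun a => ContinuousLinearMap.ext fun m =>
      congrArg (fun b : absoluteGaloisGroup K => ρ b m) (hcc a)⟩
  refine ⟨oneCocycleClass ρ.toTopRep (contOneCocycles.pullback cd.conj ι g), ?_⟩
  rw [galoisCohomology.pullback_one_oneCocycleClass]
  refine congrArg _ (Subtype.ext (ContinuousMap.ext fun a => ?_))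
  rw [contOneCocycles.pullback_apply, contOneCocycles.pullback_apply]
  exact congrArg (fun b : absoluteGaloisGroup K => g.1 b) (hcc a)

end ConjugationDatum

namespace DualityDatum

variable {R : Type} [CommRing R] [Module R M] [TopologicalSpace R] [DiscreteTopology R]
  {p : ℕ} [Fact p.Prime] [Algebra ℤ_[p] R] {cd : ConjugationDatum K} {ρ : DiscreteGaloisModule K M}
  [Finite M] (D : DualityDatum p cd ρ R) {k : ℕ}
  (lam : R →+ ZMod (p ^ k))
  (hlam : ∀ (z : ℤ_[p]) (r : R), lam (algebraMap ℤ_[p] R z * r) = PadicInt.toZModPow k z * lam r)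
  (exp : ZMod (p ^ k) →+ MuCarrier K (p ^ k))
  (hexp : ∀ (g : absoluteGaloisGroup K) (x : ZMod (p ^ k)),
    exp (cyclotomicCharacterModPow K p k g * x) = mu K (p ^ k) g (exp x))

/-- **Every class of `H¹(K, T^∨(1))` is `Θ_*(τ^* d)`** for `Θ = toTateDual λ exp` bijective (`H¹(Θ)` is then
bijective, `galoisCohomology.map_one_surjective_of_bijective`) and `τ^*` onto (§1).
[cite: Howard2004HeegnerKolyvagin, §1.3 H.4 (arXiv p. 7 L69–90: `T^* ≅ Tw(T)` under the pairing) and §2.1] [cite: SerreGaloisCohomology1997, Ch. I §2.2] -/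
theorem exists_eq_map_toTateDual_pullback (hΘ : Bijective (D.toTateDual lam hlam exp hexp))
    (y : galoisCohomology (ρ.tateDual (p ^ k)) 1) :
    ∃ d : galoisCohomology ρ 1,
      y = galoisCohomology.map (D.toTateDual lam hlam exp hexp) 1 (galoisCohomology.pullback ρ cd.conj 1 d) := by
  obtain ⟨y', rfl⟩ := galoisCohomology.map_one_surjective_of_bijective (D.toTateDual lam hlam exp hexp) hΘ y
  obtain ⟨d, rfl⟩ := cd.pullback_conj_one_surjective ρ y'; exact ⟨d, rfl⟩

/-! ## §2 Reading the dual local condition `(𝓕_v)^*` on `T^∨(1)` back to `𝓕_{σ v}` on `T` -/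

/-- The local Tate pairing of a LOCAL class `x ∈ H¹(K_v, T)` with the localization of `Θ_*(τ^* d)`, in Howard's
currency: `⟨x, (Θ τ^* d)_v⟩_{Tate} = H²(exp ∘ λ)(x ∪_e transport_v (loc_{σ v} d))` (the variant of
`localTatePairing_localization_toTateDual_pullback` with an arbitrary local first argument).
[cite: Howard2004HeegnerKolyvagin, §1.3 H.4 (arXiv p. 7 L78–82) and Lemma 1.5.6 (p. 10 L88–91)] -/
theorem localTatePairing_toTateDual_pullback (v : HeightOneSpectrum (𝓞 K))
    (x : galoisCohomology (ρ.toLocal (Sum.inr v)) 1) (d : galoisCohomology ρ 1) :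
    localTatePairing ρ (p ^ k) (Sum.inr v) x
        (galoisCohomology.localization (ρ.tateDual (p ^ k)) (Sum.inr v) 1
          (galoisCohomology.map (D.toTateDual lam hlam exp hexp) 1
            (galoisCohomology.pullback ρ cd.conj 1 d))) =
      cohomologyMap (D.expLamLocalHom lam hlam exp hexp (Sum.inr v)) 2
        (D.localCup (Sum.inr v) x
          (cd.transportH1 ρ v (galoisCohomology.localization ρ (Sum.inr (cd.σ • v)) 1 d))) := by
  rw [DiscreteGaloisModule.localization_map_one, ConjugationDatum.localization_pullback_conj,
    D.cohomologyMap_localCup_eq_localTatePairing lam hlam exp hexp]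

/-- **«`loc_v(Θ_* τ^* d) ∈ (𝓕_v)^*` ⇒ `loc_{σ v} d ∈ 𝓕_{σ v}`».**  At a finite place `v` let `𝓕` be
self-orthogonal under `D` (H.4: `𝓕_v` and the transport of `𝓕_{σ v}` are exact annihilators under `∪_e`),
`𝓕_v` stable under the scalars `r_i` of a dualizing family of `R` for `(λ, exp)`, and `inv_v` injective.  If the
localization at `v` of `Θ_*(τ^* d)` annihilates `𝓕_v` under the local Tate pairing read through `inv_v`
(`LocalInvariants.dualLocalCondition`), then `loc_{σ v} d ∈ 𝓕_{σ v}`: the readings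
`inv_v H²(exp∘λ)((r_i • a) ∪_e z)` of `z = transport_v(loc_{σv} d)` against `a ∈ 𝓕_v` all vanish, so
`a ∪_e z = 0` (family readout), so `z` lies in the transport of `𝓕_{σ v}` (H.4), and the transport is
injective. [cite: Howard2004HeegnerKolyvagin, §1.3 H.4 (arXiv p. 7 L78–82: «its own exact orthogonal complement») and Def. 1.1.6/1.1.10 (dual conditions)] [cite: MilneADT2006, Ch. I Cor. 2.3] -/
theorem localization_smul_mem_of_mem_dualLocalCondition (hρ : ρ.IsScalarLinear R)
    (inv : LocalInvariants K (p ^ k)) {ι : Type} [Finite ι] (r : ι → R)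
    (hbij : Bijective fun x : R => fun i : ι => exp (lam (r i * x)))
    (𝓕 : SelmerStructure ρ) (v : HeightOneSpectrum (𝓞 K)) (hinj : Injective (inv (Sum.inr v)))
    (horth : D.IsSelfOrthogonalAt 𝓕 v)
    (hstab : ∀ i, ∀ a ∈ 𝓕 (Sum.inr v), galoisCohomology.scalarMapH1 (ρ.toLocal (Sum.inr v))
      (isScalarLinear_toLocal hρ (Sum.inr v)) (r i) a ∈ 𝓕 (Sum.inr v))
    (d : galoisCohomology ρ 1)
    (hd : galoisCohomology.localization (ρ.tateDual (p ^ k)) (Sum.inr v) 1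
        (galoisCohomology.map (D.toTateDual lam hlam exp hexp) 1 (galoisCohomology.pullback ρ cd.conj 1 d)) ∈
      inv.dualLocalCondition ρ (Sum.inr v) (𝓕 (Sum.inr v))) :
    galoisCohomology.localization ρ (Sum.inr (cd.σ • v)) 1 d ∈ 𝓕 (Sum.inr (cd.σ • v)) := by
  -- `z = transport_v (loc_{σ v} d)` annihilates `𝓕_v` under `∪_e` itself
  have key : ∀ a ∈ 𝓕 (Sum.inr v), D.localCup (Sum.inr v) a
      (cd.transportH1 ρ v (galoisCohomology.localization ρ (Sum.inr (cd.σ • v)) 1 d)) = 0 := by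
    intro a ha
    refine D.eq_zero_of_forall_cohomologyMap_expLam_lamMul_eq_zero lam hlam exp hexp r hbij (Sum.inr v) _
      fun i => ?_
    rw [D.cohomologyMap_expLam_lamMul_localCup_left lam hlam exp hexp hρ (Sum.inr v) (r i)]
    have h := (LocalInvariants.mem_dualLocalCondition_iff _ _ _ _ _).1 hd _ (hstab i a ha)
    rw [localTatePairingZMod_apply, D.localTatePairing_toTateDual_pullback lam hlam exp hexp] at h
    exact hinj (h.trans (map_zero _).symm)
  -- H.4, second clause: `z` lies in the transport of `𝓕_{σ v}`; the transport is injective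
  obtain ⟨w, hw, hwe⟩ := AddSubgroup.mem_map.1 (((horth).2 _).2 key)
  rw [← ConjugationDatum.transportH1_injective cd ρ v hwe]
  exact hw

/-! ## §3 «`A^⟂ ⊆ A`»: Howard Thm. 1.1.11 (`SelmerComplement`) for the pair (strict at `q`, relaxed at `q`) -/

/-- **Howard 2004, Lemma 1.5.6, `⊇` («`A^⟂ ⊆ A`») at an inert prime `q`, for the induced local pairing of H.4.**
Setting: `T` finite killed by `p^k`; `inv` a family of local invariant maps with Poitou–Tate duality for Selmer
structures in Howard's form (`SelmerComplement`, Thm. 1.1.11) and `inv_v` injective at the finite places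
(`IsPerfect`); `Θ = toTateDual λ exp` bijective and `(r_i)` a dualizing family of `R` for `(λ, exp)`; `S` a
finite set of places containing `q` and the archimedean places and, outside `S`, `p ∤ v` and `T` unramified;
`𝓡` a Selmer structure unramified outside `S` with `𝓡_q = H¹(K_q, T)` (RELAXED at `q`) and `𝓡_v = 𝓕_v` at the
finite `v ≠ q`, where `𝓕` is self-orthogonal under `D` (H.4) and `r_i`-stable at every finite `v ≠ q`; all
classes of `T` localise to `0` at the infinite places (`K` imaginary quadratic in the source); `σ q = q`.
CLAIM: if `x ∈ H¹(K_q, T)` satisfies `x ∪_e transport_q(loc_{σ q} d) = 0` for every `d ∈ H¹_𝓡(K, T)`, then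
`x = loc_q c` for some `c ∈ H¹_𝓡(K, T)`.  («By global duality … `A = A^⟂`», `A = loc_q H¹_{𝓕^q(n)}(K, T)`.)
[cite: Howard2004HeegnerKolyvagin, Lemma 1.5.6 (arXiv:1202.6340 Lemma 2.5.6, p. 10 L80–97) and Thm. 1.1.11 (arXiv Thm. 2.1.11, p. 6)] [cite: MilneADT2006, Ch. I Thm. 4.10(b)] -/
theorem exists_mem_selmerGroup_localization_eq_of_forall_localCup_eq_zero
    (hn : ∀ m : M, (p ^ k) • m = 0) (hρ : ρ.IsScalarLinear R)
    (inv : LocalInvariants K (p ^ k)) (hSC : inv.SelmerComplement)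
    (hinj : ∀ v : HeightOneSpectrum (𝓞 K), Injective (inv (Sum.inr v)))
    (hΘ : Bijective (D.toTateDual lam hlam exp hexp))
    {ι : Type} [Finite ι] (r : ι → R) (hbij : Bijective fun x : R => fun i : ι => exp (lam (r i * x)))
    (S : Finset (Place K))
    (hS : ∀ v : HeightOneSpectrum (𝓞 K), (Sum.inr v : Place K) ∉ S →
      ((p ^ k : ℕ) : 𝓞 K) ∉ v.asIdeal ∧ GaloisRep.IsUnramifiedAt v ρ)
    (𝓕 𝓡 : SelmerStructure ρ) {q : HeightOneSpectrum (𝓞 K)} (hq : cd.σ • q = q)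
    (hqS : (Sum.inr q : Place K) ∈ S) (h𝓡S : 𝓡.IsUnramifiedOutside S)
    (hrel : 𝓡 (Sum.inr q) = ⊤)
    (hoff : ∀ v : HeightOneSpectrum (𝓞 K), v ≠ q → 𝓡 (Sum.inr v) = 𝓕 (Sum.inr v))
    (horth : ∀ v : HeightOneSpectrum (𝓞 K), v ≠ q → D.IsSelfOrthogonalAt 𝓕 v)
    (hstab : ∀ v : HeightOneSpectrum (𝓞 K), v ≠ q → ∀ i, ∀ a ∈ 𝓕 (Sum.inr v),
      galoisCohomology.scalarMapH1 (ρ.toLocal (Sum.inr v)) (isScalarLinear_toLocal hρ (Sum.inr v)) (r i) a ∈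
        𝓕 (Sum.inr v))
    (hinf : ∀ (w : InfinitePlace K) (c : galoisCohomology ρ 1),
      galoisCohomology.localization ρ (Sum.inl w) 1 c = 0)
    (x : galoisCohomology (ρ.toLocal (Sum.inr q)) 1)
    (hx : ∀ d ∈ 𝓡.selmerGroup, D.localCup (Sum.inr q) x
      (cd.transportH1 ρ q (galoisCohomology.localization ρ (Sum.inr (cd.σ • q)) 1 d)) = 0) :
    ∃ c ∈ 𝓡.selmerGroup, galoisCohomology.localization ρ (Sum.inr q) 1 c = x := by
  classical
  -- the structure STRICT at `q`, equal to `𝓡` elsewhere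
  obtain ⟨𝓢, h𝓢q, h𝓢v⟩ : ∃ 𝓢 : SelmerStructure ρ, 𝓢 (Sum.inr q) = ⊥ ∧
      ∀ v : Place K, v ≠ Sum.inr q → 𝓢 v = 𝓡 v :=
    ⟨Function.update 𝓡 (Sum.inr q) ⊥, Function.update_self _ _ _,
      fun v hv => Function.update_of_ne hv _ _⟩
  have hle : 𝓢 ≤ 𝓡 := fun v => by
    by_cases hv : v = Sum.inr q
    · rw [hv, h𝓢q]; exact bot_le
    · rw [h𝓢v v hv]
  have h𝓢S : 𝓢.IsUnramifiedOutside S :=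
    ⟨h𝓡S.1, fun v hv => by
      rw [h𝓢v (Sum.inr v) (fun h => hv (by rw [h]; exact hqS))]
      exact h𝓡S.2 v hv⟩
  -- the tuple `t = (x at q, 0 elsewhere)`
  obtain ⟨t, htq, htv⟩ : ∃ t : Π v : Place K, galoisCohomology (ρ.toLocal v) 1,
      t (Sum.inr q) = x ∧ ∀ v : Place K, v ≠ Sum.inr q → t v = 0 :=
    ⟨Function.update (fun _ => 0) (Sum.inr q) x, Function.update_self _ _ _,
      fun v hv => Function.update_of_ne hv _ _⟩
  have ht𝓡 : ∀ v ∈ S, t v ∈ 𝓡 v := by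
    intro v _
    by_cases hv : v = Sum.inr q
    · subst hv; rw [htq, hrel]; trivial
    · rw [htv v hv]; exact zero_mem _
  -- the pairing hypothesis of Thm. 1.1.11 (i): only the term at `q` survives, and it vanishes by `hx`
  have hpair : ∀ y ∈ (inv.dualSelmerStructure ρ 𝓢).selmerGroup,
      ∑ v ∈ S, localTatePairingZMod ρ (p ^ k) v (inv v) (t v)
        (galoisCohomology.localization (ρ.tateDual (p ^ k)) v 1 y) = 0 := by
    intro y hy
    rw [Finset.sum_eq_single_of_mem (Sum.inr q : Place K) hqS
      (fun v _ hv => by rw [htv v hv, map_zero, AddMonoidHom.zero_apply]), htq]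
    obtain ⟨d, rfl⟩ := D.exists_eq_map_toTateDual_pullback lam hlam exp hexp hΘ y
    -- the local conditions of `y = Θ_*(τ^* d)` off `q` say `d ∈ H¹_𝓡(K, T)`
    have hd : d ∈ 𝓡.selmerGroup := by
      rw [SelmerStructure.mem_selmerGroup_iff]
      rintro (w | u)
      · rw [hinf w d]; exact zero_mem _
      · by_cases hu : u = q
        · rw [hu, hrel]; trivial
        · have hv : cd.σ • u ≠ q := cd.smul_ne_of_ne hq hu
          have hyv := (SelmerStructure.mem_selmerGroup_iff _ _).1 hy (Sum.inr (cd.σ • u))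
          rw [LocalInvariants.dualSelmerStructure_apply,
            h𝓢v (Sum.inr (cd.σ • u)) (fun h => hv (Sum.inr_injective h)), hoff _ hv] at hyv
          have hmem := D.localization_smul_mem_of_mem_dualLocalCondition lam hlam exp hexp hρ inv r hbij 𝓕
            (cd.σ • u) (hinj _) (horth _ hv) (hstab _ hv) d hyv
          rw [cd.smul_smul_place] at hmem
          rw [hoff u hu]
          exact hmem
    rw [localTatePairingZMod_apply, D.localTatePairing_toTateDual_pullback lam hlam exp hexp, hx d hd]
    exact (congrArg (inv (Sum.inr q)) (map_zero _)).trans (map_zero _)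
  -- Poitou–Tate: `t` is a localization modulo `𝓢`
  obtain ⟨c, hc, hcS⟩ := (hSC ρ hn S hS 𝓢 𝓡 hle h𝓢S h𝓡S).1 t ht𝓡 hpair
  refine ⟨c, hc, ?_⟩
  have h := hcS (Sum.inr q) hqS
  rw [h𝓢q, htq, AddSubgroup.mem_bot, sub_eq_zero] at h
  exact h

/-! ## §4 «`A ⊆ A^⟂`» for `∪_e` itself, and «`A = A^⟂`» as one statement -/

include hlam hexp in
/-- **«`A ⊆ A^⟂`» for the `R(1)`-valued pairing itself**: for `c, d` satisfying the self-orthogonal,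
`r_i`-stable conditions `𝓕_v` at every finite `v ≠ q` (classes of the structure RELAXED at the inert `q`)
and localising to `0` at the infinite places, `loc_q c ∪_e transport_q(loc_{σ q} d) = 0` in `H²(K_q, R(1))`
— the readings `inv_q H²(exp ∘ λ_{r_i})(·) = inv_q H²(exp ∘ λ)(loc_q (r_i • c) ∪_e ·)` all vanish by
reciprocity (`inv_cohomologyMap_localCup_transportH1_eq_zero`), and the characters `exp ∘ λ_{r_i}` detect
`H²(K_q, R(1))`. [cite: Howard2004HeegnerKolyvagin, Lemma 1.5.6 (arXiv p. 10 L86–93: «which shows that `A ⊂ A^⟂`»)] [cite: MilneADT2006, Ch. I Thm. 4.10 (reciprocity) and Cor. 2.3] -/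
theorem localCup_localization_transportH1_eq_zero (hn : ∀ m : M, (p ^ k) • m = 0)
    (hρ : ρ.IsScalarLinear R) (inv : LocalInvariants K (p ^ k)) (hPT : inv.SumLocalTermEqZero)
    {ι : Type} [Finite ι] (r : ι → R) (hbij : Bijective fun x : R => fun i : ι => exp (lam (r i * x)))
    (𝓕 : SelmerStructure ρ) {q : HeightOneSpectrum (𝓞 K)} (hq : cd.σ • q = q)
    (hinj : Injective (inv (Sum.inr q : Place K)))
    (horth : ∀ v : HeightOneSpectrum (𝓞 K), v ≠ q → D.IsSelfOrthogonalAt 𝓕 v)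
    (hstab : ∀ v : HeightOneSpectrum (𝓞 K), v ≠ q → ∀ i, ∀ a ∈ 𝓕 (Sum.inr v),
      galoisCohomology.scalarMapH1 (ρ.toLocal (Sum.inr v)) (isScalarLinear_toLocal hρ (Sum.inr v)) (r i) a ∈
        𝓕 (Sum.inr v))
    {c d : galoisCohomology ρ 1}
    (hc : ∀ v : HeightOneSpectrum (𝓞 K), v ≠ q →
      galoisCohomology.localization ρ (Sum.inr v) 1 c ∈ 𝓕 (Sum.inr v))
    (hd : ∀ v : HeightOneSpectrum (𝓞 K), v ≠ q →
      galoisCohomology.localization ρ (Sum.inr v) 1 d ∈ 𝓕 (Sum.inr v))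
    (hinf : ∀ (w : InfinitePlace K) (c : galoisCohomology ρ 1),
      galoisCohomology.localization ρ (Sum.inl w) 1 c = 0) :
    D.localCup (Sum.inr q) (galoisCohomology.localization ρ (Sum.inr q) 1 c)
      (cd.transportH1 ρ q (galoisCohomology.localization ρ (Sum.inr (cd.σ • q)) 1 d)) = 0 := by
  refine D.eq_zero_of_forall_cohomologyMap_expLam_lamMul_eq_zero lam hlam exp hexp r hbij (Sum.inr q) _
    fun i => ?_
  rw [D.cohomologyMap_expLam_lamMul_localCup_left lam hlam exp hexp hρ (Sum.inr q) (r i),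
    ← galoisCohomology.localization_scalarMapH1 hρ (Sum.inr q) (r i) c]
  refine D.cohomologyMap_localCup_transportH1_eq_zero lam hlam exp hexp hn inv hPT 𝓕 hq hinj horth
    (fun v hv => ?_) hd (fun w => hinf w _)
  rw [galoisCohomology.localization_scalarMapH1 hρ (Sum.inr v) (r i) c]
  exact hstab v hv i _ (hc v hv)

/-- **Howard 2004, Lemma 1.5.6 at an inert prime: «`A = A^⟂`» for `A = loc_q H¹_𝓡(K, T)`** under the induced
local pairing `(x, a) ↦ x ∪_e transport_q a` of H.4 — both inclusions as one equivalence, in the hypotheses of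
`exists_mem_selmerGroup_localization_eq_of_forall_localCup_eq_zero` plus reciprocity (`SumLocalTermEqZero`):
`x ∈ loc_q(H¹_𝓡(K, T)) ↔ ∀ d ∈ H¹_𝓡(K, T), x ∪_e transport_q(loc_{σ q} d) = 0`.  This is the hypothesis
«`A` maximal isotropic» of Lemma 1.5.7 / Prop. 1.5.9 for `𝓡 = 𝓕^q(n)`.
[cite: Howard2004HeegnerKolyvagin, Lemma 1.5.6 (arXiv:1202.6340 Lemma 2.5.6, p. 10 L80–97) and Lemma 1.5.7 (p. 10 L112–113: «`A` is maximal isotropic by the previous lemma»)] [cite: MilneADT2006, Ch. I Thm. 4.10(b)] -/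
theorem mem_map_localization_selmerGroup_iff_forall_localCup_eq_zero
    (hn : ∀ m : M, (p ^ k) • m = 0) (hρ : ρ.IsScalarLinear R)
    (inv : LocalInvariants K (p ^ k)) (hPT : inv.SumLocalTermEqZero) (hSC : inv.SelmerComplement)
    (hinj : ∀ v : HeightOneSpectrum (𝓞 K), Injective (inv (Sum.inr v)))
    (hΘ : Bijective (D.toTateDual lam hlam exp hexp))
    {ι : Type} [Finite ι] (r : ι → R) (hbij : Bijective fun x : R => fun i : ι => exp (lam (r i * x)))
    (S : Finset (Place K))
    (hS : ∀ v : HeightOneSpectrum (𝓞 K), (Sum.inr v : Place K) ∉ S →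
      ((p ^ k : ℕ) : 𝓞 K) ∉ v.asIdeal ∧ GaloisRep.IsUnramifiedAt v ρ)
    (𝓕 𝓡 : SelmerStructure ρ) {q : HeightOneSpectrum (𝓞 K)} (hq : cd.σ • q = q)
    (hqS : (Sum.inr q : Place K) ∈ S) (h𝓡S : 𝓡.IsUnramifiedOutside S)
    (hrel : 𝓡 (Sum.inr q) = ⊤)
    (hoff : ∀ v : HeightOneSpectrum (𝓞 K), v ≠ q → 𝓡 (Sum.inr v) = 𝓕 (Sum.inr v))
    (horth : ∀ v : HeightOneSpectrum (𝓞 K), v ≠ q → D.IsSelfOrthogonalAt 𝓕 v)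
    (hstab : ∀ v : HeightOneSpectrum (𝓞 K), v ≠ q → ∀ i, ∀ a ∈ 𝓕 (Sum.inr v),
      galoisCohomology.scalarMapH1 (ρ.toLocal (Sum.inr v)) (isScalarLinear_toLocal hρ (Sum.inr v)) (r i) a ∈
        𝓕 (Sum.inr v))
    (hinf : ∀ (w : InfinitePlace K) (c : galoisCohomology ρ 1),
      galoisCohomology.localization ρ (Sum.inl w) 1 c = 0)
    (x : galoisCohomology (ρ.toLocal (Sum.inr q)) 1) :
    x ∈ 𝓡.selmerGroup.map (galoisCohomology.localization ρ (Sum.inr q) 1) ↔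
      ∀ d ∈ 𝓡.selmerGroup, D.localCup (Sum.inr q) x
        (cd.transportH1 ρ q (galoisCohomology.localization ρ (Sum.inr (cd.σ • q)) 1 d)) = 0 := by
  constructor
  · intro hx d hd
    obtain ⟨c, hc, rfl⟩ := AddSubgroup.mem_map.1 hx
    rw [SelmerStructure.mem_selmerGroup_iff] at hc hd
    exact D.localCup_localization_transportH1_eq_zero lam hlam exp hexp hn hρ inv hPT r hbij 𝓕 hq (hinj q)
      horth hstab (fun v hv => hoff v hv ▸ hc (Sum.inr v)) (fun v hv => hoff v hv ▸ hd (Sum.inr v)) hinf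
  · intro hx
    exact D.exists_mem_selmerGroup_localization_eq_of_forall_localCup_eq_zero lam hlam exp
      hexp hn hρ inv hSC hinj hΘ r hbij S hS 𝓕 𝓡 hq hqS h𝓡S hrel hoff horth hstab hinf x hx

/-- **«`A = A^⟂`», local form**: with `A = loc_q(H¹_𝓡(K, T)) ≤ H¹(K_q, T)` and the pairing
`(x, a) ↦ x ∪_e transport_q(a)` on `H¹(K_q, T)` (the class `a` cast to `H¹(K_{σ q}, T)` along the place
datum `σ q = q`, `InertLocalTauProofs.cast_localization`): `x ∈ A ↔ ∀ a ∈ A, x ∪_e transport_q(a) = 0` —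
the shape `∀ x, x ∈ A ↔ ∀ a ∈ A, B x a = 0` of the hypothesis `hA` of the Lagrangian algebra
(`LagrangianSubmodulesDeltaTransfer.forall_pow_smul_eq_zero_of_lagrangian`).
[cite: Howard2004HeegnerKolyvagin, Lemma 1.5.6 (arXiv:1202.6340 Lemma 2.5.6, p. 10 L80–97) and Lemma 1.5.7 (p. 10 L112–113)] [cite: MilneADT2006, Ch. I Thm. 4.10(b)] -/
theorem mem_map_localization_selmerGroup_iff_forall_localCup_cast_eq_zero
    (hn : ∀ m : M, (p ^ k) • m = 0) (hρ : ρ.IsScalarLinear R)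
    (inv : LocalInvariants K (p ^ k)) (hPT : inv.SumLocalTermEqZero) (hSC : inv.SelmerComplement)
    (hinj : ∀ v : HeightOneSpectrum (𝓞 K), Injective (inv (Sum.inr v)))
    (hΘ : Bijective (D.toTateDual lam hlam exp hexp))
    {ι : Type} [Finite ι] (r : ι → R) (hbij : Bijective fun x : R => fun i : ι => exp (lam (r i * x)))
    (S : Finset (Place K))
    (hS : ∀ v : HeightOneSpectrum (𝓞 K), (Sum.inr v : Place K) ∉ S →
      ((p ^ k : ℕ) : 𝓞 K) ∉ v.asIdeal ∧ GaloisRep.IsUnramifiedAt v ρ)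
    (𝓕 𝓡 : SelmerStructure ρ) {q : HeightOneSpectrum (𝓞 K)} (hq : cd.σ • q = q)
    (hqS : (Sum.inr q : Place K) ∈ S) (h𝓡S : 𝓡.IsUnramifiedOutside S)
    (hrel : 𝓡 (Sum.inr q) = ⊤)
    (hoff : ∀ v : HeightOneSpectrum (𝓞 K), v ≠ q → 𝓡 (Sum.inr v) = 𝓕 (Sum.inr v))
    (horth : ∀ v : HeightOneSpectrum (𝓞 K), v ≠ q → D.IsSelfOrthogonalAt 𝓕 v)
    (hstab : ∀ v : HeightOneSpectrum (𝓞 K), v ≠ q → ∀ i, ∀ a ∈ 𝓕 (Sum.inr v),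
      galoisCohomology.scalarMapH1 (ρ.toLocal (Sum.inr v)) (isScalarLinear_toLocal hρ (Sum.inr v)) (r i) a ∈
        𝓕 (Sum.inr v))
    (hinf : ∀ (w : InfinitePlace K) (c : galoisCohomology ρ 1),
      galoisCohomology.localization ρ (Sum.inl w) 1 c = 0)
    (x : galoisCohomology (ρ.toLocal (Sum.inr q)) 1) :
    x ∈ 𝓡.selmerGroup.map (galoisCohomology.localization ρ (Sum.inr q) 1) ↔
      ∀ a ∈ 𝓡.selmerGroup.map (galoisCohomology.localization ρ (Sum.inr q) 1),
        D.localCup (Sum.inr q) x (cd.transportH1 ρ q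
          (hq.symm ▸ a : galoisCohomology (ρ.toLocal (Sum.inr (cd.σ • q))) 1)) = 0 := by
  rw [D.mem_map_localization_selmerGroup_iff_forall_localCup_eq_zero lam hlam exp hexp hn hρ inv hPT hSC hinj
    hΘ r hbij S hS 𝓕 𝓡 hq hqS h𝓡S hrel hoff horth hstab hinf x]
  constructor
  · rintro h a ⟨d, hd, rfl⟩
    rw [cast_localization ρ hq.symm d]
    exact h d hd
  · intro h d hd
    rw [← cast_localization ρ hq.symm d]
    exact h _ ⟨d, hd, rfl⟩

end DualityDatum

end Literature.NumberTheory.GaloisCohomology.Howard2004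

end
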